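import Summits.QuantumAdvantage.AdviceFreeQNC0.DWalkOneBell
import Literature.Computability.MetaComplexity.LowDegreeComposition

/-!
# StakeDial — part A: the `𝔽₃` top character, degrees in walk coordinates, and the PRODUCT NORMAL FORM of perfection

Support package for `SupportDial` (items 27380 `NoPerfectConst3` / 31929 `MinorityLift3`; decomp-qadv lens-1, gen 9,
node «StakeDial» (revs 1–4 were called «BudgetDial»), `pub/decomp-qadv/decomp-qadv-lens-1/g9/StakeDial.lean`).  Setting: the `(n+1)`-cycle ring-HLF game on
the odd class, transported to the walk cube `u ∈ {0,1}ⁿ` by `AdviceFreeQNC0.WalkTransport` (`xOfU`, `ringWinU`,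
`rel_iff_ringWinU`); a strategy is a column table `P : Fin (n+1) → CubeFn (ZMod 3) (n+1)` answering `[P g x = 1]`.

* §A `ind` — Boolean indicators inside `𝔽₃` and their algebra (`one_add_ind_xor`, `prod_one_add_ind`, …).
* §B `topWt` / `topChar T f = Σ_u (−1)^{|u ∩ T|} f(u)` and `topChar_eq_zero_of_mem_lowDeg` : `d < |T|` ⟹ `χ_T` kills
  `Smolensky.lowDeg (ZMod 3) n d` (involution on a coordinate of `T` missing from a monomial).
* §C degree costs in walk coordinates: chart bits `ind_xOfU_mem` (degree `2`), composed events `comp_xOfU_mem` (`2d`),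
  output events `zeta_mem` (`4d`), the affine STAKE `stake_mem` (`1`) and ring mask `rho = stake²` (`rho_mem`, `2`),
  one factor of the normal form `factor_mem` (`4d+2`).
* §D `canon n = S_n = Π_g (1 + τ_g ρ_g) ∈ {±1}` (`canon_mul_self`), `ringWinU_of_perfect`, and the PRODUCT NORMAL FORM
  `prod_eq_neg_canon` : a strategy perfect on the odd class satisfies `Π_g (1 + ζ_g(u) ρ_g(u)) = − S_n(u)` at every walk point.

Prop-free data only (`def`s are `𝔽₃`-valued functions); no type-class instances, no new notation, no placeholders, kernel `decide` only.
Parts B (budget law, dead-stake law, tightness) and C (kernel instances, unconditional corollaries) import this file.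
-/

set_option linter.dupNamespace false
set_option linter.style.longLine false

namespace Summit.QuantumAdvantage.QuantumAdvantage.Theorems.StakeDial

open Finset
open Literature.Computability.QuantumComplexity.RingHLF (Rel)
open Literature.Computability.MetaComplexity.Smolensky
open Summit.QuantumAdvantage.AdviceFreeQNC0 (OddZeros xOfU uVec uExt tGuess ringWinU walkExp wtPrefix
  rel_iff_ringWinU xOfU_uVec card_odd_filter_ge)

variable {n : ℕ}

/-! ### A. `𝔽₃` bookkeeping for Boolean indicators -/

/-- The `0/1` indicator of a Boolean inside `𝔽₃`. -/
def ind (b : Bool) : ZMod 3 := if b then 1 else 0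

/-- StakeDialA helper `ind_true` (decomp-qadv land package; see the module docstring). -/
@[simp] theorem ind_true : ind true = 1 := rfl
/-- StakeDialA helper `ind_false` (decomp-qadv land package; see the module docstring). -/
@[simp] theorem ind_false : ind false = 0 := rfl

/-- StakeDialA helper `ind_and` (decomp-qadv land package; see the module docstring). -/
theorem ind_and (a b : Bool) : ind (a && b) = ind a * ind b := by
  cases a <;> cases b <;> rfl

/-- The XOR of two bits, masked by a third, FACTORS multiplicatively in `𝔽₃`:
`1 + [a ⊕ t]·[m] = (1 + [a][m]) (1 + [t][m])` (because `2 = -1` and `[m]² = [m]`). -/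
theorem one_add_ind_xor (a t m : Bool) :
    1 + ind (xor a t) * ind m = (1 + ind a * ind m) * (1 + ind t * ind m) := by
  cases a <;> cases t <;> cases m <;> decide

/-- Each factor `1 + [t][m] ∈ {1, 2}` squares to `1`. -/
theorem one_add_ind_mul_self (t m : Bool) : (1 + ind t * ind m) * (1 + ind t * ind m) = 1 := by
  cases t <;> cases m <;> decide

/-- `Π_g (1 + [b g]) = (-1)^{#{g : b g}}` in `𝔽₃` (`1 + 1 = -1`). -/
theorem prod_one_add_ind {ι : Type*} [DecidableEq ι] (s : Finset ι) (b : ι → Bool) :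
    ∏ g ∈ s, (1 + ind (b g)) = (-1 : ZMod 3) ^ (s.filter fun g => b g = true).card := by
  induction s using Finset.induction_on with
  | empty => simp
  | insert a s ha ih =>
    rw [prod_insert ha, ih]
    cases hb : b a
    · have hf : (insert a s).filter (fun g => b g = true) = s.filter (fun g => b g = true) := by
        rw [filter_insert, if_neg (by rw [hb]; exact Bool.false_ne_true)]
      rw [hf, ind_false, add_zero, one_mul]
    · have hf : (insert a s).filter (fun g => b g = true) =
          insert a (s.filter fun g => b g = true) := by
        rw [filter_insert, if_pos hb]
      rw [hf, card_insert_of_notMem (fun h => ha (mem_filter.1 h).1), pow_succ,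
        show (1 : ZMod 3) + ind true = -1 from by decide]
      ring

/-! ### B. The top character on a coordinate set `T` and its vanishing on low degree -/

/-- Weight of the `T`-character functional: supported-in-`T` patterns, signed by `Π_{i∈T} (-1)^{u_i}`. -/
def topWt (T : Finset (Fin n)) (u : Fin n → Bool) : ZMod 3 :=
  if (∀ i, i ∉ T → u i = false) then pmMono (ZMod 3) T u else 0

/-- `χ_T(F) = Σ_u topWt_T(u) · F(u)` — up to sign the Möbius (multilinear) coefficient of `F` at `T`. -/
def topChar (T : Finset (Fin n)) (F : CubeFn (ZMod 3) n) : ZMod 3 := ∑ u, topWt T u * F u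

/-- StakeDialA helper `sgn_update_self` (decomp-qadv land package; see the module docstring). -/
theorem sgn_update_self (u : Fin n → Bool) (j : Fin n) :
    sgn (ZMod 3) (Function.update u j (!u j)) j = - sgn (ZMod 3) u j := by
  unfold sgn; rw [Function.update_self]; cases u j <;> simp

/-- StakeDialA helper `sgn_update_of_ne` (decomp-qadv land package; see the module docstring). -/
theorem sgn_update_of_ne (u : Fin n → Bool) {i j : Fin n} (h : i ≠ j) (c : Bool) :
    sgn (ZMod 3) (Function.update u j c) i = sgn (ZMod 3) u i := by
  unfold sgn; rw [Function.update_of_ne h]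

/-- StakeDialA helper `pmMono_update` (decomp-qadv land package; see the module docstring). -/
theorem pmMono_update (T : Finset (Fin n)) {j : Fin n} (hj : j ∈ T) (u : Fin n → Bool) :
    pmMono (ZMod 3) T (Function.update u j (!u j)) = - pmMono (ZMod 3) T u := by
  unfold pmMono
  rw [← Finset.mul_prod_erase T _ hj, ← Finset.mul_prod_erase T (fun i => sgn (ZMod 3) u i) hj,
    sgn_update_self, neg_mul]
  congr 2
  exact Finset.prod_congr rfl fun i hi => sgn_update_of_ne u (Finset.ne_of_mem_erase hi) _

/-- StakeDialA helper `topWt_update` (decomp-qadv land package; see the module docstring). -/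
theorem topWt_update (T : Finset (Fin n)) {j : Fin n} (hj : j ∈ T) (u : Fin n → Bool) :
    topWt T (Function.update u j (!u j)) = - topWt T u := by
  unfold topWt
  have hiff : (∀ i, i ∉ T → Function.update u j (!u j) i = false) ↔ (∀ i, i ∉ T → u i = false) := by
    refine forall_congr' fun i => forall_congr' fun hi => ?_
    rw [Function.update_of_ne (fun h => hi (by rw [h]; exact hj))]
  by_cases h : ∀ i, i ∉ T → u i = false
  · rw [if_pos (hiff.2 h), if_pos h, pmMono_update T hj]
  · rw [if_neg (fun h' => h (hiff.1 h')), if_neg h, neg_zero]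

/-- StakeDialA helper `mono_update_of_not_mem` (decomp-qadv land package; see the module docstring). -/
theorem mono_update_of_not_mem {S : Finset (Fin n)} {j : Fin n} (hj : j ∉ S) (u : Fin n → Bool)
    (c : Bool) : mono (ZMod 3) S (Function.update u j c) = mono (ZMod 3) S u := by
  unfold mono
  exact Finset.prod_congr rfl fun i hi => by rw [Function.update_of_ne (ne_of_mem_of_not_mem hi hj)]

/-- A monomial `x_S` with `|S| < |T|` is killed by `χ_T` (flip a coordinate `j ∈ T \ S`: the weight
changes sign, the monomial does not). -/
theorem topChar_mono_eq_zero {T S : Finset (Fin n)} (h : S.card < T.card) :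
    topChar T (mono (ZMod 3) S) = 0 := by
  obtain ⟨j, hjT, hjS⟩ := Finset.exists_mem_notMem_of_card_lt_card h
  unfold topChar
  refine Finset.sum_ninvolution (fun u => Function.update u j (!u j)) (fun u => ?_) (fun u _ => ?_)
    (fun u => Finset.mem_univ _) (fun u => ?_)
  · rw [topWt_update T hjT, mono_update_of_not_mem hjS]; ring
  · intro hu
    have h' := congrFun hu j
    rw [Function.update_self] at h'
    exact Bool.not_ne_self _ h'
  · rw [Function.update_self, Function.update_idem, Bool.not_not, Function.update_eq_self]

/-- **`χ_T` kills every polynomial of degree `< |T|`.** -/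
theorem topChar_eq_zero_of_mem_lowDeg {T : Finset (Fin n)} {d : ℕ} (hd : d < T.card)
    {F : CubeFn (ZMod 3) n} (hF : F ∈ lowDeg (ZMod 3) n d) : topChar T F = 0 := by
  rw [lowDeg_eq_span] at hF
  induction hF using Submodule.span_induction with
  | mem x hx =>
    obtain ⟨⟨S, hS⟩, rfl⟩ := hx
    exact topChar_mono_eq_zero (hS.trans_lt hd)
  | zero => simp [topChar]
  | add x y _ _ hx hy =>
    unfold topChar at hx hy ⊢
    simp only [Pi.add_apply, mul_add, Finset.sum_add_distrib, hx, hy, add_zero]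
  | smul c x _ hx =>
    unfold topChar at hx ⊢
    have : ∑ u, topWt T u * (c • x) u = c * ∑ u, topWt T u * x u := by
      rw [Finset.mul_sum]
      exact Finset.sum_congr rfl fun u _ => by simp only [Pi.smul_apply, smul_eq_mul]; ring
    rw [this, hx, mul_zero]

/-! ### C. Degrees in walk coordinates: chart, events, ring mask -/

/-- StakeDialA helper `one_mem_lowDeg` (decomp-qadv land package; see the module docstring). -/
theorem one_mem_lowDeg (D : ℕ) : (1 : CubeFn (ZMod 3) n) ∈ lowDeg (ZMod 3) n D := by
  rw [← mono_empty]; exact mono_mem_lowDeg (by simp)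

/-- StakeDialA helper `const_mem_lowDeg` (decomp-qadv land package; see the module docstring). -/
theorem const_mem_lowDeg (c : ZMod 3) (D : ℕ) :
    (fun _ : Fin n → Bool => c) ∈ lowDeg (ZMod 3) n D := by
  have : (fun _ : Fin n → Bool => c) = c • (1 : CubeFn (ZMod 3) n) := by
    funext u; simp
  rw [this]; exact Submodule.smul_mem _ c (one_mem_lowDeg D)

/-- StakeDialA helper `ind_coord_mem` (decomp-qadv land package; see the module docstring). -/
theorem ind_coord_mem (i : Fin n) : (fun u : Fin n → Bool => ind (u i)) ∈ lowDeg (ZMod 3) n 1 := by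
  have : (fun u : Fin n → Bool => ind (u i)) = mono (ZMod 3) {i} := by
    funext u
    rw [mono_apply]
    simp only [Finset.mem_singleton, forall_eq]
    rfl
  rw [this]; exact mono_mem_lowDeg (by simp)

/-- StakeDialA helper `ind_uExt_mem` (decomp-qadv land package; see the module docstring). -/
theorem ind_uExt_mem (j : ℕ) : (fun u : Fin n → Bool => ind (uExt u j)) ∈ lowDeg (ZMod 3) n 1 := by
  by_cases hj : j < n
  · have : (fun u : Fin n → Bool => ind (uExt u j)) = fun u => ind (u ⟨j, hj⟩) := by
      funext u; simp [Summit.QuantumAdvantage.AdviceFreeQNC0.uExt, hj]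
    rw [this]; exact ind_coord_mem ⟨j, hj⟩
  · have : (fun u : Fin n → Bool => ind (uExt u j)) = fun _ => 1 := by
      funext u; simp [Summit.QuantumAdvantage.AdviceFreeQNC0.uExt, hj]
    rw [this]; exact const_mem_lowDeg 1 1

/-- **The chart has `𝔽₃`-degree `2`**: every coordinate `x_j = ¬(u_j ⊕ u_{j-1})` of `xOfU` has the
indicator `1 - [u_j] - [u_{j-1}] - [u_j][u_{j-1}]` (`2 = -1`). -/
theorem ind_xOfU_mem (j : Fin (n + 1)) :
    (fun u : Fin n → Bool => if xOfU u j = true then (1 : ZMod 3) else 0) ∈ lowDeg (ZMod 3) n 2 := by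
  have hAm : (fun u : Fin n → Bool => ind (uExt u j.val)) ∈ lowDeg (ZMod 3) n 1 := ind_uExt_mem j.val
  have hBm : (fun u : Fin n → Bool => ind (if j.val = 0 then false else uExt u (j.val - 1))) ∈
      lowDeg (ZMod 3) n 1 := by
    by_cases h0 : j.val = 0
    · have : (fun u : Fin n → Bool => ind (if j.val = 0 then false else uExt u (j.val - 1))) =
          fun _ => 0 := by
        funext u; rw [if_pos h0]; rfl
      rw [this]; exact const_mem_lowDeg 0 1
    · have : (fun u : Fin n → Bool => ind (if j.val = 0 then false else uExt u (j.val - 1))) =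
          fun u => ind (uExt u (j.val - 1)) := by
        funext u; rw [if_neg h0]
      rw [this]; exact ind_uExt_mem (j.val - 1)
  have key : ∀ a b : Bool, (if (!xor a b) = true then (1 : ZMod 3) else 0) =
      1 - ind a - ind b - ind a * ind b := by
    intro a b; cases a <;> cases b <;> decide
  have heq : (fun u : Fin n → Bool => if xOfU u j = true then (1 : ZMod 3) else 0) =
      1 - (fun u : Fin n → Bool => ind (uExt u j.val)) -
        (fun u : Fin n → Bool => ind (if j.val = 0 then false else uExt u (j.val - 1))) -
        ((fun u : Fin n → Bool => ind (uExt u j.val)) *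
          (fun u : Fin n → Bool => ind (if j.val = 0 then false else uExt u (j.val - 1)))) := by
    funext u
    simp only [Pi.sub_apply, Pi.mul_apply, Pi.one_apply]
    exact key (uExt u j.val) (if j.val = 0 then false else uExt u (j.val - 1))
  rw [heq]
  have hAB := mul_mem_lowDeg_add hAm hBm
  rw [show (1 : ℕ) + 1 = 2 from rfl] at hAB
  have h12 : (1 : ℕ) ≤ 2 := by norm_num
  exact Submodule.sub_mem _ (Submodule.sub_mem _ (Submodule.sub_mem _ (one_mem_lowDeg 2)
    (lowDeg_mono h12 hAm)) (lowDeg_mono h12 hBm)) hAB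

/-- Composition with the chart doubles the degree at most. -/
theorem comp_xOfU_mem {d : ℕ} {P : CubeFn (ZMod 3) (n + 1)} (hP : P ∈ lowDeg (ZMod 3) (n + 1) d) :
    (fun u : Fin n → Bool => P (xOfU u)) ∈ lowDeg (ZMod 3) n (d * 2) :=
  comp_mem_lowDeg_of_coord_mul xOfU ind_xOfU_mem hP

/-- The output event `[P(x) = 1]` of one column, read in walk coordinates. -/
def zeta (P : CubeFn (ZMod 3) (n + 1)) : CubeFn (ZMod 3) n := fun u => ind (decide (P (xOfU u) = 1))

/-- StakeDialA helper `ind_eq_one_formula` (decomp-qadv land package; see the module docstring). -/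
theorem ind_eq_one_formula (a : ZMod 3) : ind (decide (a = 1)) = 1 - (a - 1) * (a - 1) := by
  revert a; decide

/-- A degree-`d` output event costs `𝔽₃`-degree `≤ 4d` in walk coordinates. -/
theorem zeta_mem {d : ℕ} {P : CubeFn (ZMod 3) (n + 1)} (hP : P ∈ lowDeg (ZMod 3) (n + 1) d) :
    zeta P ∈ lowDeg (ZMod 3) n (4 * d) := by
  set Q : CubeFn (ZMod 3) n := fun u => P (xOfU u) with hQ
  have hQm : Q ∈ lowDeg (ZMod 3) n (d * 2) := comp_xOfU_mem hP
  have heq : zeta P = 1 - (Q - 1) * (Q - 1) := by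
    funext u
    simp only [zeta, hQ, Pi.sub_apply, Pi.mul_apply, Pi.one_apply]
    exact ind_eq_one_formula _
  rw [heq]
  have h1 : (Q - 1) ∈ lowDeg (ZMod 3) n (d * 2) := Submodule.sub_mem _ hQm (one_mem_lowDeg _)
  have h2 := mul_mem_lowDeg_add h1 h1
  rw [show d * 2 + d * 2 = 4 * d by ring] at h2
  exact Submodule.sub_mem _ (one_mem_lowDeg _) h2

/-- The ring mask of column `g` at charge `n + 2`: `ρ_g(u) = [(n + 2 + g + e_g(u)) % 3 ≠ 0]`
(`WalkTransport.ringWinU`). -/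
def rho (n : ℕ) (g : ℕ) : CubeFn (ZMod 3) n :=
  fun u => ind (decide ((n + 2 + g + walkExp u g) % 3 ≠ 0))
/-- StakeDialA helper `ind_mod_three_ne_zero` (decomp-qadv land package; see the module docstring). -/
theorem ind_mod_three_ne_zero (m : ℕ) :
    ind (decide (m % 3 ≠ 0)) = (m : ZMod 3) * (m : ZMod 3) := by
  have h : (m : ZMod 3) = ((m % 3 : ℕ) : ZMod 3) := (ZMod.natCast_mod m 3).symm
  rw [h]
  have hlt : m % 3 < 3 := Nat.mod_lt _ (by norm_num)
  generalize m % 3 = r at hlt ⊢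
  interval_cases r <;> decide
/-- StakeDialA helper `natCast_wt` (decomp-qadv land package; see the module docstring). -/
theorem natCast_wt (u : Fin n → Bool) :
    ((Summit.QuantumAdvantage.AdviceFreeQNC0.wt u : ℕ) : ZMod 3) = ∑ i, ind (u i) := by
  unfold Summit.QuantumAdvantage.AdviceFreeQNC0.wt
  rw [Finset.card_filter, Nat.cast_sum]
  refine Finset.sum_congr rfl fun i _ => ?_
  cases u i <;> simp
/-- StakeDialA helper `natCast_wtPrefix` (decomp-qadv land package; see the module docstring). -/
theorem natCast_wtPrefix (u : Fin n → Bool) (g : ℕ) :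
    ((wtPrefix u g : ℕ) : ZMod 3) = ∑ i, (if i.val < g then ind (u i) else 0) := by
  unfold Summit.QuantumAdvantage.AdviceFreeQNC0.wtPrefix
  rw [Finset.card_filter, Nat.cast_sum]
  refine Finset.sum_congr rfl fun i _ => ?_
  by_cases h : i.val < g <;> cases u i <;> simp [h]
/-- The stake `n + 2 + g + e_g(u)` read in `𝔽₃`. -/
def stake (n g : ℕ) : CubeFn (ZMod 3) n := fun u => ((n + 2 + g + walkExp u g : ℕ) : ZMod 3)
/-- The stake is an AFFINE form of the walk bits (`DWalkOneBell.stake_eq_affine`): degree `≤ 1`. -/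
theorem stake_mem (g : ℕ) : stake n g ∈ lowDeg (ZMod 3) n 1 := by
  have hAeq : stake n g = (fun _ => ((n + 2 + g : ℕ) : ZMod 3)) + (∑ i : Fin n, fun u => ind (u i)) +
      ∑ i : Fin n, fun u => if i.val < g then ind (u i) else 0 := by
    funext u
    simp only [stake, Pi.add_apply, Finset.sum_apply, Summit.QuantumAdvantage.AdviceFreeQNC0.walkExp,
      Nat.cast_add, natCast_wt, natCast_wtPrefix]
    ring
  rw [hAeq]
  refine Submodule.add_mem _ (Submodule.add_mem _ (const_mem_lowDeg _ 1)
    (Submodule.sum_mem _ fun i _ => ind_coord_mem i)) (Submodule.sum_mem _ fun i _ => ?_)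
  by_cases h : i.val < g
  · have : (fun u : Fin n → Bool => if i.val < g then ind (u i) else 0) = fun u => ind (u i) := by
      funext u; rw [if_pos h]
    rw [this]; exact ind_coord_mem i
  · have : (fun u : Fin n → Bool => if i.val < g then ind (u i) else 0) = fun _ => 0 := by
      funext u; rw [if_neg h]
    rw [this]; exact const_mem_lowDeg 0 1
/-- **The ring mask has `𝔽₃`-degree `2`**: `[a ≠ 0] = a²` in `𝔽₃` applied to the affine stake. -/
theorem rho_mem (g : ℕ) : rho n g ∈ lowDeg (ZMod 3) n 2 := by
  have heq : rho n g = stake n g * stake n g := by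
    funext u
    rw [Pi.mul_apply]
    have h := ind_mod_three_ne_zero (n + 2 + g + walkExp u g)
    unfold rho stake
    rw [← h]
  have h2 := mul_mem_lowDeg_add (stake_mem (n := n) g) (stake_mem (n := n) g)
  rw [show (1 : ℕ) + 1 = 2 from rfl] at h2
  rw [heq]; exact h2
/-- **Cost of one active column**: the factor `1 + ζ_g ρ_g` has degree `≤ 4d + 2`. -/
theorem factor_mem {d : ℕ} {P : CubeFn (ZMod 3) (n + 1)} (hP : P ∈ lowDeg (ZMod 3) (n + 1) d)
    (g : ℕ) : (1 + zeta P * rho n g) ∈ lowDeg (ZMod 3) n (4 * d + 2) :=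
  Submodule.add_mem _ (lowDeg_mono (by omega) (one_mem_lowDeg 0))
    (mul_mem_lowDeg_add (zeta_mem hP) (rho_mem g))

/-! ### D. The `𝔽₃` product normal form of a PERFECT strategy -/
/-- The canonical guess read in walk coordinates. -/
def tau (n : ℕ) (g : Fin (n + 1)) : CubeFn (ZMod 3) n := fun u => ind (tGuess (xOfU u) g)
/-- **The canonical sign function** `S_n(u) = Π_g (1 + τ_g(u) ρ_g(u)) ∈ {±1}`: `(-1)^{#canonical bells that ring}`. -/
def canon (n : ℕ) : CubeFn (ZMod 3) n := fun u => ∏ g : Fin (n + 1), (1 + tau n g u * rho n g.val u)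
/-- StakeDialA helper `canon_mul_self` (decomp-qadv land package; see the module docstring). -/
theorem canon_mul_self (u : Fin n → Bool) : canon n u * canon n u = 1 := by
  unfold canon
  rw [← Finset.prod_mul_distrib]
  refine Finset.prod_eq_one fun g _ => ?_
  unfold tau rho
  exact one_add_ind_mul_self _ _
/-- Step 1 (transport, tree theorems `rel_iff_ringWinU` + `card_odd_filter_ge`): a strategy that is
perfect on the odd class wins the walk game at EVERY point of the `u`-cube. -/
theorem ringWinU_of_perfect (hn : 2 ≤ n) (z : (Fin (n + 1) → Bool) → (Fin (n + 1) → Bool))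
    (hperf : ∀ x : Fin (n + 1) → Bool, OddZeros x → Rel x (z x)) (u : Fin n → Bool) :
    ringWinU (n + 2) (fun g u => xor (z (xOfU u) g) (tGuess (xOfU u) g)) u = true := by
  set y : Fin (n + 1) → (Fin n → Bool) → Bool := fun g u => xor (z (xOfU u) g) (tGuess (xOfU u) g)
    with hy
  have h := card_odd_filter_ge hn (fun u => ¬ (ringWinU (n + 2) y u = true))
  have h0 : (univ.filter fun x : Fin (n + 1) → Bool =>
      (univ.filter fun j : Fin (n + 1) => x j = false).card % 2 = 1 ∧
        ¬ (ringWinU (n + 2) y (uVec x) = true)).card = 0 := by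
    rw [Finset.card_eq_zero, Finset.filter_eq_empty_iff]
    rintro x - ⟨hodd, hnot⟩
    exact hnot ((rel_iff_ringWinU hn x hodd z).1 (hperf x hodd))
  rw [h0, zero_add] at h
  have hall : (univ.filter fun u : Fin n → Bool => ¬¬(ringWinU (n + 2) y u = true)) = univ := by
    apply Finset.eq_univ_of_card
    refine le_antisymm (Finset.card_le_univ _) ?_
    rw [Fintype.card_fun, Fintype.card_bool, Fintype.card_fin]
    exact h
  have hu : u ∈ univ.filter fun u : Fin n → Bool => ¬¬(ringWinU (n + 2) y u = true) := by
    rw [hall]; exact mem_univ _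
  exact not_not.1 (mem_filter.1 hu).2
/-- **The product normal form.** A strategy `z_g = [P_g = 1]` perfect on the odd class of the
`(n+1)`-cycle satisfies, identically on the walk cube `{0,1}ⁿ`,
`Π_g (1 + ζ_g(u) ρ_g(u)) = − S_n(u)`. -/
theorem prod_eq_neg_canon (hn : 2 ≤ n) (P : Fin (n + 1) → CubeFn (ZMod 3) (n + 1))
    (hperf : ∀ x : Fin (n + 1) → Bool, OddZeros x → Rel x (fun i => decide (P i x = 1)))
    (u : Fin n → Bool) :
    ∏ g : Fin (n + 1), (1 + zeta (P g) u * rho n g.val u) = - canon n u := by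
  have hwin := ringWinU_of_perfect hn (fun x i => decide (P i x = 1)) hperf u
  unfold Summit.QuantumAdvantage.AdviceFreeQNC0.ringWinU at hwin
  rw [decide_eq_true_eq] at hwin
  have hwin' : (univ.filter fun g : Fin (n + 1) =>
      xor (decide (P g (xOfU u) = 1)) (tGuess (xOfU u) g) = true ∧
        (n + 2 + g.val + walkExp u g.val) % 3 ≠ 0).card % 2 = 1 := hwin
  -- all factors together: (-1)^{odd} = -1
  have hprod : ∏ g : Fin (n + 1),
      (1 + ind (xor (decide (P g (xOfU u) = 1)) (tGuess (xOfU u) g)) * rho n g.val u) = -1 := by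
    have hf : ∀ g : Fin (n + 1),
        (1 + ind (xor (decide (P g (xOfU u) = 1)) (tGuess (xOfU u) g)) * rho n g.val u) =
        1 + ind ((xor (decide (P g (xOfU u) = 1)) (tGuess (xOfU u) g)) &&
          decide ((n + 2 + g.val + walkExp u g.val) % 3 ≠ 0)) := by
      intro g; unfold rho; rw [ind_and]
    rw [Finset.prod_congr rfl fun g _ => hf g, prod_one_add_ind]
    have hset : (univ.filter fun g : Fin (n + 1) =>
        ((xor (decide (P g (xOfU u) = 1)) (tGuess (xOfU u) g)) &&
          decide ((n + 2 + g.val + walkExp u g.val) % 3 ≠ 0)) = true) =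
        univ.filter fun g : Fin (n + 1) =>
          xor (decide (P g (xOfU u) = 1)) (tGuess (xOfU u) g) = true ∧
            (n + 2 + g.val + walkExp u g.val) % 3 ≠ 0 := by
      refine Finset.filter_congr fun g _ => ?_
      rw [Bool.and_eq_true, decide_eq_true_eq]
    rw [hset]
    obtain ⟨k, hk⟩ := Nat.odd_iff.2 hwin'
    rw [hk, pow_succ, pow_mul]
    norm_num
  have hsplit : ∀ g : Fin (n + 1),
      (1 + ind (xor (decide (P g (xOfU u) = 1)) (tGuess (xOfU u) g)) * rho n g.val u) =
      (1 + zeta (P g) u * rho n g.val u) * (1 + tau n g u * rho n g.val u) := by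
    intro g; unfold zeta tau rho; exact one_add_ind_xor _ _ _
  rw [Finset.prod_congr rfl fun g _ => hsplit g, Finset.prod_mul_distrib] at hprod
  have hc := canon_mul_self (n := n) u
  unfold canon at hc ⊢
  calc ∏ g : Fin (n + 1), (1 + zeta (P g) u * rho n g.val u)
      = (∏ g : Fin (n + 1), (1 + zeta (P g) u * rho n g.val u)) *
          ((∏ g : Fin (n + 1), (1 + tau n g u * rho n g.val u)) *
            ∏ g : Fin (n + 1), (1 + tau n g u * rho n g.val u)) := by rw [hc, mul_one]
    _ = -1 * ∏ g : Fin (n + 1), (1 + tau n g u * rho n g.val u) := by rw [← mul_assoc, hprod]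
    _ = - ∏ g : Fin (n + 1), (1 + tau n g u * rho n g.val u) := neg_one_mul _

end Summit.QuantumAdvantage.QuantumAdvantage.Theorems.StakeDial
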